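import Summits.QuantumFields.YangMills.Theorems.LuscherReductionTwistedTraceScalingSlowDisintegrationTubes
import Summits.QuantumFields.YangMills.Theorems.LuscherReductionOneSiteLevelsGnPullback
import HarnessLib

/-!
# Definitions for the FLAT DENSITY of the transverse measure `π = orthoTransverse L` of the orthographic tube («(E′)-lite»):
# the flat parametrisation `balExt` of the balanced subspace, its Lebesgue measure `balLebesgue`, and the flat chart map `orthoFlat` with its linearisation
# (route `FlatTubeReduction`, crux K1 `NearFlatRatioLaw` stmt-QuantumFields-24720; seat `ym-line-ftr-p1` g16; shared infrastructure of the rate twin «ratepack-v5» and of lane A's (C1);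
# R2b1 RECORD rung — no summit statement is proved here)

WHY (memo `Cruxes/NearFlatRatioLaw/Lines/ratepack-v5-nearpair-g16.md` §5).  The hN/W package of the rate twin at profile radius `r_B = β^{-1/2}·log β` needs the
«profile numbers» of the stiff Gaussian profile to be CONSTANTS, which requires the transverse measure `π` of lane A's orthographic tube
(`…SlowDisintegrationTubes.orthoTransverse`, an abstract marginal of product Haar measure) to be comparable, two-sidedly near `v = 0`, with a LEBESGUE measure on the
balanced subspace `{v | Σ_x v_{(x,k)} = 0}`.  This file only fixes the objects of that comparison (the theorems are in the sequels `…OrthoDensity*`):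
* `balExt L` — the linear parametrisation of the balanced subspace by the coordinates off the base site `x = 0` (the base coordinates are the balancing sums
  `v_{(0,k)} = −Σ_{x≠0} v_{(x,k)}`), a continuous linear map `({e // e.1 ≠ 0} → ℝ³) →L (Edge → ℝ³)`; `balFill L y = balExt L (y|_{x≠0})`;
* `balLebesgue L = (balExt L)_* vol` — Lebesgue measure of the balanced subspace in these coordinates (a Haar measure of the subspace; any other differs by a constant);
* `baseGno L y` — the one-site (slow) variable read from the base coordinates of `y` through the GNOMONIC chart `gnoPoint` (Haar density `(2π²)⁻¹(1+|b|²)⁻²`,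
  tree `GnChart.pi_haar_su2_eq_sum_piPatternChart`);
* `orthoFlat L y` — the gnomonic coordinates `gnLink` of the tube point `orthoTube L (baseGno L y) (balFill L y)`, written as the explicit rational–radical formula
  `((p₀b + v + v × b)/(p₀ − v·b))_e`, `v = (balFill L y)_e`, `b = y_{(0,k(e))}`, `p₀ = √(1−|v|²)` (the identification with `gnLink ∘ orthoTube` is proved in the sequel);
* `orthoFlatLin L` — its differential at `0`: `y ↦ (v_e + b_{k(e)})_e`, an INJECTIVE linear map of `Edge → ℝ³` (balance forces `b = 0`).
HONEST FRAMING: definitions only; femto rung R2b1 (RECORD label); not infinite volume, not a gap, not Clay.  No named facts, no `sorry`.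
-/

set_option autoImplicit false

noncomputable section

open MeasureTheory Filter Topology Real
open scoped BigOperators Matrix
open Literature.MathematicalPhysics.QuantumFieldTheory
open Literature.MathematicalPhysics.QuantumLattice
open Literature.MathematicalPhysics.QuantumFieldTheory.Balaban1983to89.T4CubeChartGnomonic (gnoPoint)

namespace Summit.QuantumFields.YangMills.Theorems.FemtoTransferGap.TwoLattice.ConstTube

open Summit.QuantumFields.YangMills.Theorems.FemtoTransferGap

variable (L : ℕ) [NeZero L]

/-! ## §1 The flat parametrisation of the balanced subspace -/

/-- **The balanced extension**: coordinates `w` off the base site `x = 0` are extended to the base links by the balancing sums `v_{(0,k)} = −Σ_{x≠0} w_{(x,k)}`;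
a continuous linear map onto the balanced subspace. [folklore] -/
def balExt : (({e : Edge 3 L // ¬e.1 = 0}) → Fin 3 → ℝ) →L[ℝ] (Edge 3 L → Fin 3 → ℝ) :=
  LinearMap.toContinuousLinearMap
    { toFun := fun w e a => if h : e.1 = 0 then -∑ x : {x : Site 3 L // ¬x = 0}, w ⟨(x.1, e.2), x.2⟩ a else w ⟨e, h⟩ a
      map_add' := fun w w' => by
        funext e a
        by_cases h : e.1 = 0
        · simp only [h, dite_true, Pi.add_apply, Finset.sum_add_distrib, neg_add]
        · simp only [h, dite_false, Pi.add_apply]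
      map_smul' := fun c w => by
        funext e a
        by_cases h : e.1 = 0
        · simp only [h, dite_true, Pi.smul_apply, smul_eq_mul, RingHom.id_apply, Finset.mul_sum, mul_neg]
        · simp only [h, dite_false, Pi.smul_apply, smul_eq_mul, RingHom.id_apply] }

/-- The balanced extension, evaluated. [folklore] -/
theorem balExt_apply (w : {e : Edge 3 L // ¬e.1 = 0} → Fin 3 → ℝ) (e : Edge 3 L) (a : Fin 3) :
    balExt L w e a = if h : e.1 = 0 then -∑ x : {x : Site 3 L // ¬x = 0}, w ⟨(x.1, e.2), x.2⟩ a else w ⟨e, h⟩ a := rfl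

/-- **The balancing fill** of an arbitrary coordinate vector: keep the coordinates off the base site, replace the base coordinates by the balancing sums. [folklore] -/
def balFill (y : Edge 3 L → Fin 3 → ℝ) : Edge 3 L → Fin 3 → ℝ := balExt L fun e' => y e'.1

/-- The balancing fill, evaluated. [folklore] -/
theorem balFill_apply (y : Edge 3 L → Fin 3 → ℝ) (e : Edge 3 L) (a : Fin 3) :
    balFill L y e a = if e.1 = 0 then -∑ x : {x : Site 3 L // ¬x = 0}, y (x.1, e.2) a else y e a := by
  unfold balFill
  rw [balExt_apply]
  by_cases h : e.1 = 0 <;> simp [h]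

/-- **Lebesgue measure of the balanced subspace** in the off-base coordinates: the image of `vol` on `({e // e.1 ≠ 0} → ℝ³)` under `balExt`. [folklore] -/
def balLebesgue : Measure (Edge 3 L → Fin 3 → ℝ) := Measure.map (balExt L) volume

/-! ## §2 The flat chart map of the orthographic tube -/

/-- **The base slow variable** read through the gnomonic chart: `(baseGno L y)_k = P(1, y_{(0,k)})`. [folklore] -/
def baseGno (y : Edge 3 L → Fin 3 → ℝ) : GaugeConfig 3 1 SU2 := fun e₁ => gnoPoint (y ((0 : Site 3 L), e₁.2))

/-- **The flat chart map** `G` of the orthographic tube: the gnomonic coordinates of the link `(orthoTube L (baseGno L y) (balFill L y))_e = chartSU2(v_e)·P(1,b_{k(e)})`,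
namely `(p₀ b + v + v × b)/(p₀ − v·b)` with `v = (balFill L y)_e`, `b = y_{(0,k(e))}`, `p₀ = √(1 − |v|²)`. [folklore] -/
def orthoFlat (y : Edge 3 L → Fin 3 → ℝ) : Edge 3 L → Fin 3 → ℝ := fun e a =>
  (Real.sqrt (1 - ∑ c, balFill L y e c ^ 2) * y (0, e.2) a + balFill L y e a + (balFill L y e ⨯₃ y (0, e.2)) a) /
    (Real.sqrt (1 - ∑ c, balFill L y e c ^ 2) - balFill L y e ⬝ᵥ y (0, e.2))

/-- **The linearisation of the flat chart map at `0`**: `y ↦ ((balFill L y)_e + y_{(0,k(e))})_e`. [folklore] -/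
def orthoFlatLin : (Edge 3 L → Fin 3 → ℝ) →L[ℝ] (Edge 3 L → Fin 3 → ℝ) :=
  (balExt L).comp (ContinuousLinearMap.pi fun e' : {e : Edge 3 L // ¬e.1 = 0} => ContinuousLinearMap.proj (R := ℝ) (φ := fun _ : Edge 3 L => Fin 3 → ℝ) e'.1) +
    ContinuousLinearMap.pi fun e : Edge 3 L => ContinuousLinearMap.proj (R := ℝ) (φ := fun _ : Edge 3 L => Fin 3 → ℝ) ((0 : Site 3 L), e.2)

/-- The linearisation, evaluated. [folklore] -/
theorem orthoFlatLin_apply (y : Edge 3 L → Fin 3 → ℝ) (e : Edge 3 L) (a : Fin 3) : orthoFlatLin L y e a = balFill L y e a + y (0, e.2) a := rfl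

end Summit.QuantumFields.YangMills.Theorems.FemtoTransferGap.TwoLattice.ConstTube

end
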